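import Literature.IUT.LogVolume.GenuineTowerBadPlaceExact
import Literature.NumberTheory.EllipticCurves.TateCurve.TorsionRootNumberField
import Literature.NumberTheory.EllipticCurves.TateCurve.SplitOfRationalTorsionHolds
import Literature.NumberTheory.EllipticCurves.TorsionCardinality
import Literature.IUT.LogVolume.GenuineSupportPrimesBound
import HarnessLib

/-!
# The `F`-layer of a genuine Θ-volume datum at a bad place: SPLIT multiplicative reduction and the `30`-th root of
# the Tate parameter ⟹ `30 ∣ e(w | v₀) · ord_{v₀} j(λ)` (Stage 2a of the WILD local type, abc-iut R-W GAP G-Wnum2-1)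

Mochizuki, *Inter-universal Teichmüller theory IV*, Thm. 1.10 p. 22 ("the `(3·5)`-torsion points of `E_F` are defined
over `F`", with the `2·3`-torsion of [IUTchI] Def. 3.1 (b)): every `30`-torsion point of `E_F` is `F`-rational
(`Cor22.ThetaVolumeDatumAt.torsion_thirty_rational`); J. H. Silverman, *Advanced Topics in the Arithmetic of Elliptic
Curves* (1994), Thm. V.5.3 / Cor. V.5.4 (Tate uniformisation; the tree's
`TateCurve.hasSplitMultiplicativeReductionAt_of_card_torsion`: `n²` rational `n`-torsion points, `n ≥ 3`, at a
multiplicative place force SPLIT reduction; `TateCurve.exists_pow_eq_tateParameter_of_torsion_at`: they force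
`q_w = rⁿ`, `|j|_w = |r|_w⁻ⁿ`); Silverman *AEC* Cor. III.6.4 (b) (`#E[n] = n²`, the tree's `card_torsionBy_eq_sq`).

For a genuine Θ-volume datum `T : Cor22.ThetaVolumeDatumAt P l` and a place `w` of `F = T.F` over a BAD place `v₀`
of `λ` (so `E_F`, semistable with `j(E_F) = j(λ)`, is multiplicative at `w`):

* `ThetaVolumeDatumAt.exists_finset_torsion_F` — for `0 < n ∣ 30`, `n²` points of `E_F(F)` killed by `n`
  (all `n²` geometric `n`-torsion points descend, `torsion_thirty_rational`);
* `ThetaVolumeDatumAt.hasSplitMultiplicativeReductionAt_F_of_badPlaces` — **`E_F` has SPLIT multiplicative reduction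
  at `w`** (the `3²` rational `3`-torsion points);
* `ThetaVolumeDatumAt.dvd_ord_j_of_dvd_thirty` — `n ∣ ord_w j(E_F)` for `0 < n ∣ 30` (`q_w = rⁿ`);
* **`ThetaVolumeDatumAt.thirty_dvd_ord_j`** — `30 ∣ ord_w j(E_F)`;
* **`ThetaVolumeDatumAt.thirty_dvd_ramificationIdx_mul_ord`** — `30 ∣ e(w | v₀) · ord_{v₀} j(λ)` (`j(E_F) = j(λ)` read
  through `F_tpd ⊆ F`, the tree's `Cor22.ord_algebraMap_eq`); hence, at a pole of `j(λ)` of order `2t`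
  (`ord_{v₀} j(λ) = −2t`), **`15 ∣ e(w | v₀) · t`** (`fifteen_dvd_ramificationIdx_mul`), i.e.
  `(15/gcd(15,t)) ∣ e(w | v₀)` — the TAME factor `r = p′/gcd(p′,t)` AND, when `p ∤ t`, the wild factor `p` of
  the local type `e(F_w/ℚ_p) = e_W·r` of the abc-iut R-W window table (W-num-2 N1-WILD-EXACT §1), as a LOWER bound
  valid at EVERY bad prime INCLUDING `p ∈ {3, 5}` (no tameness used).

Proof-only (no definition, no named fact); inputs BY NAME; classical; TAKES NO SIDE on [IUTchIII] Cor. 3.12.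
[cite: Mochizuki2012, IUTchIV Thm. 1.10 p. 22] [cite: SilvermanATAEC1994, V.5 Thm. 5.3 and Cor. 5.4]
[claim: Mochizuki2012, status: disputed] for every IUT quotation.
-/

noncomputable section

open scoped Classical

namespace Literature.IUT.LogVolume

namespace Cor22

namespace ThetaVolumeDatumAt

open NumberField IsDedekindDomain Literature.NumberTheory.DiophantineGeometry.GenEll
open Literature.NumberTheory.EllipticCurves Literature.NumberTheory.EllipticCurves.TateCurve
open Literature.NumberTheory.NumberFields Literature.IUT.HodgeTheaters WeierstrassCurve Field

variable {P : NFPoint} {l : ℕ} (T : ThetaVolumeDatumAt P l)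

/-- **`n²` rational `n`-torsion points** (`0 < n ∣ 30`): the `n²` geometric `n`-torsion points of `E_F` (Silverman
III.6.4 (b), the tree's `card_torsionBy_eq_sq` over the algebraically closed `F̄`) are killed by `30`, hence
`F`-rational (`torsion_thirty_rational`), and `E_F(F) → E_F(F̄)` is injective. [cite: Mochizuki2012, IUTchIV Thm. 1.10 p. 22]
[cite: SilvermanAEC2009, Cor. III.6.4(b)] [claim: Mochizuki2012, status: disputed] -/
theorem exists_finset_torsion_F {n : ℕ} (hn0 : 0 < n) (hn : n ∣ 30) :
    letI := T.instFieldF; letI := T.instNumberFieldF; letI := T.instAlgebraF; letI := T.instFieldK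
    letI := T.instNumberFieldK; letI := T.instAlgebraK; letI := T.instFieldFbar; letI := T.instAlgebraFbar
    letI := T.instAlgebraKFbar; letI := T.instIsElliptic
    ∃ S : Finset (T.E.toAffine.baseChange T.F).Point, S.card = n ^ 2 ∧ ∀ Q ∈ S, n • Q = 0 := by
  letI := T.instFieldF; letI := T.instNumberFieldF; letI := T.instAlgebraF; letI := T.instFieldK
  letI := T.instNumberFieldK; letI := T.instAlgebraK; letI := T.instFieldFbar; letI := T.instAlgebraFbar
  letI := T.instAlgebraKFbar; letI := T.instIsElliptic
  haveI := T.D.isAlgClosure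
  haveI : IsAlgClosed T.Fbar := IsAlgClosure.isAlgClosed T.F
  haveI : (T.E.baseChange T.Fbar).IsElliptic := inferInstanceAs (T.E.map (algebraMap T.F T.Fbar)).IsElliptic
  haveI : CharZero T.Fbar := charZero_of_injective_algebraMap (algebraMap T.F T.Fbar).injective
  set ι := Affine.Point.baseChange (W' := T.E.toAffine) T.F T.Fbar with hι
  have hιinj : Function.Injective ι := Affine.Point.map_injective _
  -- the rational `n`-torsion `A` maps bijectively onto the geometric `n`-torsion
  set A : Set (T.E.toAffine.baseChange T.F).Point := {Q | n • Q = 0} with hA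
  have himage : ι '' A = (AddSubgroup.torsionBy (GeomPoints T.Fbar T.E) (n : ℤ) : Set (GeomPoints T.Fbar T.E)) := by
    ext R
    constructor
    · rintro ⟨Q, hQ, rfl⟩
      change ι Q ∈ AddSubgroup.torsionBy _ (n : ℤ)
      rw [AddSubgroup.torsionBy.nsmul_iff, ← map_nsmul, show n • Q = 0 from hQ, map_zero]
    · intro hR
      change R ∈ AddSubgroup.torsionBy _ (n : ℤ) at hR
      rw [AddSubgroup.torsionBy.nsmul_iff] at hR
      have hRz : (n : ℤ) • R = 0 := by rw [natCast_zsmul]; exact hR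
      have h30 : (30 : ℤ) • R = 0 := by
        obtain ⟨m, hm⟩ := hn
        have h30eq : (30 : ℤ) = (m : ℤ) * (n : ℤ) := by
          have := congrArg (Nat.cast : ℕ → ℤ) hm
          push_cast at this
          linarith
        rw [h30eq, mul_smul, hRz, smul_zero]
      obtain ⟨Q, hQ⟩ := T.torsion_thirty_rational R h30
      refine ⟨Q, ?_, hQ⟩
      change n • Q = 0
      apply hιinj
      rw [map_nsmul, hQ, map_zero, hR]
  have hcardB : (AddSubgroup.torsionBy (GeomPoints T.Fbar T.E) (n : ℤ) : Set (GeomPoints T.Fbar T.E)).ncard = n ^ 2 := by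
    rw [← Nat.card_coe_set_eq]
    have hnF : ((n : ℕ) : T.Fbar) ≠ 0 := by exact_mod_cast hn0.ne'
    exact card_torsionBy_eq_sq (E := T.E.baseChange T.Fbar) hnF
  have hcardA : A.ncard = n ^ 2 := by
    rw [← Set.ncard_image_of_injective A hιinj, himage, hcardB]
  have hfin : A.Finite := Set.finite_of_ncard_ne_zero (by rw [hcardA]; positivity)
  refine ⟨hfin.toFinset, ?_, fun Q hQ => ?_⟩
  · rw [← Set.ncard_eq_toFinset_card A hfin, hcardA]
  · exact (Set.Finite.mem_toFinset hfin).mp hQ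

/-- Push-forward of a finset of `F`-points killed by `n` to the completion `F_w` (injective `E_F(F) → E_F(F_w)`).
[folklore] -/
private theorem exists_finset_torsion_completion' {F : Type} [Field F] [NumberField F] (E : WeierstrassCurve F)
    (w : HeightOneSpectrum (𝓞 F)) {n : ℕ}
    (S : Finset (E.toAffine.baseChange F).Point) (hS : ∀ Q ∈ S, n • Q = 0) :
    ∃ S' : Finset (E.baseChange (w.adicCompletion F)).toAffine.Point,
      S'.card = S.card ∧ ∀ Q ∈ S', n • Q = 0 := by
  let f : F →ₐ[F] w.adicCompletion F := Algebra.ofId F (w.adicCompletion F)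
  let ι : (E.toAffine.baseChange F).Point →+ (E.toAffine.baseChange (w.adicCompletion F)).Point :=
    Affine.Point.map f
  have hι : Function.Injective ι := Affine.Point.map_injective f
  refine ⟨S.map ⟨ι, hι⟩, by rw [Finset.card_map], fun Q hQ => ?_⟩
  obtain ⟨Q₀, hQ₀, rfl⟩ := Finset.mem_map.mp hQ
  show n • ι Q₀ = 0
  rw [← map_nsmul, hS Q₀ hQ₀, map_zero]

/-- **`E_F` has SPLIT multiplicative reduction at every place of `F` over a bad place of `λ`**: it is multiplicative
there (semistable with `j(E_F) = j(λ)`) and its `3`-torsion (`9` points) is `F`-rational (Silverman *ATAEC* V.5.3 /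
Cor. V.5.4: a non-split twist kills at most `n` points of odd order `n`). [cite: SilvermanATAEC1994, V.5 Thm. 5.3 and Cor. 5.4]
[cite: Mochizuki2012, IUTchIV Thm. 1.10 p. 22] [claim: Mochizuki2012, status: disputed] -/
theorem hasSplitMultiplicativeReductionAt_F_of_badPlaces
    (w : letI := T.instFieldF; letI := T.instNumberFieldF; HeightOneSpectrum (𝓞 T.F))
    (hbad : letI := T.instFieldF; letI := T.instNumberFieldF; letI := T.instAlgebraF
      finBelow P.F T.F w ∈ badPlaces P) :
    (letI := T.instFieldF; letI := T.instNumberFieldF; letI := T.instAlgebraF; letI := T.instFieldK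
     letI := T.instNumberFieldK; letI := T.instAlgebraK; letI := T.instFieldFbar; letI := T.instAlgebraFbar
     letI := T.instAlgebraKFbar; letI := T.instIsElliptic
     T.E.HasSplitMultiplicativeReductionAt w) := by
  letI := T.instFieldF; letI := T.instNumberFieldF; letI := T.instAlgebraF; letI := T.instFieldK
  letI := T.instNumberFieldK; letI := T.instAlgebraK; letI := T.instFieldFbar; letI := T.instAlgebraFbar
  letI := T.instAlgebraKFbar; letI := T.instIsElliptic
  have hmult : T.E.HasMultiplicativeReductionAt w :=
    hasMultiplicativeReductionAt_of_isSemistable_of_j_eq T.F T.D.isSemistable T.j_eq w hbad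
  obtain ⟨S, hS, hS3⟩ := T.exists_finset_torsion_F (n := 3) (by norm_num) (by norm_num)
  obtain ⟨S', hS', hS'3⟩ := exists_finset_torsion_completion' T.E w S hS3
  exact hasSplitMultiplicativeReductionAt_of_card_torsion T.E w hmult (le_refl 3) S' hS'3 (by rw [hS', hS])

/-- **`n ∣ ord_w j(E_F)` for `0 < n ∣ 30`** at a place `w` of `F` over a bad place of `λ`: on the SPLIT Tate curve
`F_w^×/q_w^ℤ` the `n²` rational `n`-torsion points force `q_w = rⁿ`, so `|j(E_F)|_w = |r|_w⁻ⁿ`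
(`TateCurve.exists_pow_eq_tateParameter_of_torsion_at`). [cite: SilvermanATAEC1994, V.5 Thm. 5.3 (PDF pp. 407–409)]
[cite: Mochizuki2012, IUTchIV Thm. 1.10 p. 22] [claim: Mochizuki2012, status: disputed] -/
theorem dvd_ord_j_of_dvd_thirty
    (w : letI := T.instFieldF; letI := T.instNumberFieldF; HeightOneSpectrum (𝓞 T.F))
    (hbad : letI := T.instFieldF; letI := T.instNumberFieldF; letI := T.instAlgebraF
      finBelow P.F T.F w ∈ badPlaces P) {n : ℕ} (hn0 : 0 < n) (hn : n ∣ 30) :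
    (n : ℤ) ∣ (letI := T.instFieldF; letI := T.instNumberFieldF; letI := T.instAlgebraF; letI := T.instFieldK
     letI := T.instNumberFieldK; letI := T.instAlgebraK; letI := T.instFieldFbar; letI := T.instAlgebraFbar
     letI := T.instAlgebraKFbar; letI := T.instIsElliptic
     ord T.F w T.E.j) := by
  letI := T.instFieldF; letI := T.instNumberFieldF; letI := T.instAlgebraF; letI := T.instFieldK
  letI := T.instNumberFieldK; letI := T.instAlgebraK; letI := T.instFieldFbar; letI := T.instAlgebraFbar
  letI := T.instAlgebraKFbar; letI := T.instIsElliptic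
  have hsplit := T.hasSplitMultiplicativeReductionAt_F_of_badPlaces w hbad
  obtain ⟨S, hS, hSn⟩ := T.exists_finset_torsion_F hn0 hn
  obtain ⟨S', hS', hS'n⟩ := exists_finset_torsion_completion' T.E w S hSn
  obtain ⟨q, r, hq0, -, -, hrq, hv⟩ :=
    exists_pow_eq_tateParameter_of_torsion_at T.F w T.E hsplit hn0 S' hS'n (by rw [hS', hS])
  have hr0 : r ≠ 0 := by
    intro h; rw [h, zero_pow hn0.ne'] at hrq; exact hq0 hrq.symm
  have hvr0 : Valued.v r ≠ 0 := (Valuation.ne_zero_iff _).mpr hr0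
  -- `|j|_w = |r|_w⁻ⁿ` read on `F`
  have hval : w.valuation T.F T.E.j = (Valued.v r)⁻¹ ^ n := by
    rw [← hv]
    exact (IsDedekindDomain.HeightOneSpectrum.valuedAdicCompletion_eq_valuation' w T.E.j).symm
  -- `|r|_w = exp a`, so `ord_w j = n·a`
  set a : ℤ := WithZero.log (Valued.v r) with ha
  have hra : Valued.v r = WithZero.exp a := by rw [ha, WithZero.exp_log hvr0]
  refine ⟨a, ?_⟩
  unfold ord
  rw [hval, hra, ← WithZero.exp_neg, ← WithZero.exp_nsmul, WithZero.log_exp, nsmul_eq_mul]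
  ring

/-- **`30 ∣ ord_w j(E_F)`** at every place `w` of `F` over a bad place of `λ` (`q_w` is a `30`-th power in `F_w`: the
`2`-, `3`- and `5`-torsion roots of `dvd_ord_j_of_dvd_thirty` combined). [cite: SilvermanATAEC1994, V.5 Thm. 5.3]
[cite: Mochizuki2012, IUTchIV Thm. 1.10 p. 22] [claim: Mochizuki2012, status: disputed] -/
theorem thirty_dvd_ord_j
    (w : letI := T.instFieldF; letI := T.instNumberFieldF; HeightOneSpectrum (𝓞 T.F))
    (hbad : letI := T.instFieldF; letI := T.instNumberFieldF; letI := T.instAlgebraF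
      finBelow P.F T.F w ∈ badPlaces P) :
    (30 : ℤ) ∣ (letI := T.instFieldF; letI := T.instNumberFieldF; letI := T.instAlgebraF; letI := T.instFieldK
     letI := T.instNumberFieldK; letI := T.instAlgebraK; letI := T.instFieldFbar; letI := T.instAlgebraFbar
     letI := T.instAlgebraKFbar; letI := T.instIsElliptic
     ord T.F w T.E.j) := by
  have h2 := T.dvd_ord_j_of_dvd_thirty w hbad (n := 2) (by norm_num) (by norm_num)
  have h3 := T.dvd_ord_j_of_dvd_thirty w hbad (n := 3) (by norm_num) (by norm_num)
  have h5 := T.dvd_ord_j_of_dvd_thirty w hbad (n := 5) (by norm_num) (by norm_num)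
  have h6 : (6 : ℤ) ∣ _ := (Int.isCoprime_iff_gcd_eq_one.mpr (by norm_num) : IsCoprime (2 : ℤ) 3).mul_dvd h2 h3
  exact (Int.isCoprime_iff_gcd_eq_one.mpr (by norm_num) : IsCoprime (6 : ℤ) 5).mul_dvd h6 h5

/-- **`30 ∣ e(w | v₀) · ord_{v₀} j(λ)`** for every place `w` of `F` over a bad place `v₀` of `λ`: `j(E_F) = j(λ)` read
through `F_tpd ⊆ F` has `ord_w = e(w|v₀)·ord_{v₀}` (the tree's `Cor22.ord_algebraMap_eq`). Hence at a pole of order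
`2t` (`ord_{v₀} j(λ) = −2t`) the relative index satisfies `15 ∣ e(w|v₀)·t`, i.e. `(15/gcd(15,t)) ∣ e(w|v₀)` — the LOWER
half of the local type `e(F_w/ℚ_p) = e_W·r` of the abc-iut R-W window table, at EVERY bad prime (also `p ∈ {3,5}`).
[cite: Mochizuki2012, IUTchIV Thm. 1.10 p. 22] [cite: SilvermanATAEC1994, V.5 Thm. 5.3] [claim: Mochizuki2012, status: disputed] -/
theorem thirty_dvd_ramificationIdx_mul_ord
    (w : letI := T.instFieldF; letI := T.instNumberFieldF; HeightOneSpectrum (𝓞 T.F))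
    (hbad : letI := T.instFieldF; letI := T.instNumberFieldF; letI := T.instAlgebraF
      finBelow P.F T.F w ∈ badPlaces P) :
    (30 : ℤ) ∣ (letI := T.instFieldF; letI := T.instNumberFieldF; letI := T.instAlgebraF
      (w.asIdeal.ramificationIdx (𝓞 P.F) : ℤ) * ord P.F (finBelow P.F T.F w) (jInv P.x)) := by
  letI := T.instFieldF; letI := T.instNumberFieldF; letI := T.instAlgebraF; letI := T.instFieldK
  letI := T.instNumberFieldK; letI := T.instAlgebraK; letI := T.instFieldFbar; letI := T.instAlgebraFbar
  letI := T.instAlgebraKFbar; letI := T.instIsElliptic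
  have h := T.thirty_dvd_ord_j w hbad
  haveI : (finBelow P.F T.F w).asIdeal.IsMaximal := (finBelow P.F T.F w).isMaximal
  rwa [T.j_eq, Cor22.ord_algebraMap_eq w,
    Ideal.ramificationIdx'_eq_ramificationIdx (finBelow P.F T.F w).asIdeal w.asIdeal (finBelow P.F T.F w).ne_bot] at h

/-- **`15 ∣ e(w | v₀) · t` at a pole of `j(λ)` of order `2t`** (`ord_{v₀} j(λ) = −2t`): the relative ramification index
of `F/F_tpd` at a bad place carries the factor `15/gcd(15, t)`. [cite: Mochizuki2012, IUTchIV Thm. 1.10 p. 22]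
[cite: SilvermanATAEC1994, V.5 Thm. 5.3] [claim: Mochizuki2012, status: disputed] -/
theorem fifteen_dvd_ramificationIdx_mul
    (w : letI := T.instFieldF; letI := T.instNumberFieldF; HeightOneSpectrum (𝓞 T.F)) {t : ℕ}
    (hord : letI := T.instFieldF; letI := T.instNumberFieldF; letI := T.instAlgebraF
      ord P.F (finBelow P.F T.F w) (jInv P.x) = -(2 * (t : ℤ))) (ht : 0 < t) :
    15 ∣ (letI := T.instFieldF; letI := T.instNumberFieldF; letI := T.instAlgebraF
      w.asIdeal.ramificationIdx (𝓞 P.F)) * t := by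
  letI := T.instFieldF; letI := T.instNumberFieldF; letI := T.instAlgebraF
  have hbad : finBelow P.F T.F w ∈ badPlaces P := by
    rw [mem_badPlaces_iff_ord_neg, hord]
    have : (0 : ℤ) < t := by exact_mod_cast ht
    linarith
  have h := T.thirty_dvd_ramificationIdx_mul_ord w hbad
  rw [hord] at h
  have h' : (30 : ℤ) ∣ 2 * ((w.asIdeal.ramificationIdx (𝓞 P.F) : ℤ) * t) := by
    have : (w.asIdeal.ramificationIdx (𝓞 P.F) : ℤ) * -(2 * (t : ℤ)) = -(2 * ((w.asIdeal.ramificationIdx (𝓞 P.F) : ℤ) * t)) := by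
      ring
    rw [this, dvd_neg] at h
    exact h
  have h15 : (15 : ℤ) ∣ (w.asIdeal.ramificationIdx (𝓞 P.F) : ℤ) * t := by
    have h30 : (30 : ℤ) = 2 * 15 := by norm_num
    rw [h30] at h'
    exact (mul_dvd_mul_iff_left (by norm_num : (2 : ℤ) ≠ 0)).mp h'
  exact_mod_cast h15

end ThetaVolumeDatumAt

end Cor22

end Literature.IUT.LogVolume

end
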